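import Mathlib.Analysis.SpecialFunctions.Trigonometric.Bounds
import Mathlib.Algebra.Order.Round
import Mathlib.Data.Rat.Floor
import HarnessLib

/-!
# Kitaev's eigenvalue measurement, II: classical reconstruction of the phase

Family `PQC` (trunk `CryptoQuantFine`); groundwork for the quantum half of Shor's order-finding
theorem (`Literature.Computability.Cryptography.Shor1997_orderFinding_isQSolvable`, `ShorProofs.lean`) along Kitaev's route
(A. Yu. Kitaev 1995, §3). Kitaev's Lemma 10: the Hadamard tests of `U^{2^l}` localise each
`2^l φ (mod 1)`, `l < L`, coarsely ("in one of the 8 intervals `[(s-1)/8, (s+1)/8]`"); "using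
this information, one can find (by a polynomial algorithm) the value of `φ` with precision
`(1/8)·2^{-(l-1)}`". This file is that polynomial algorithm and its analysis, over an arbitrary
linearly ordered field with a floor function (the algorithm of `ShorOrderFindingQuantum` runs it
over `ℚ`; the comparison with the phases uses `ℝ`):

* `cdist a b = |a - b - round (a - b)|`, the metric of `𝕜/ℤ`, with its elementary API
  (`cdist_le_abs`, `cdist_comm`, `cdist_triangle`, shift invariance, `cdist_self_add_half`);
* `exists_halving`, `halveTowards`, `cdist_halveTowards_le` — **one refinement step**: if `a`
  is within `δ ≤ 5/32` of `2θ` and `β` within `5/32` of `θ` (mod `1`), the half of `a` nearer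
  to `β` is within `δ/2` of `θ`;
* `refineAux`, `refined`, `cdist_refineAux_le`, `cdist_refined_le` — **halving from the top
  level down**: from localisations `β l` of `2^l φ` within `5/32` (`l < L`) an estimate of `φ`
  within `(5/32)/2^{L-1}` (Kitaev's precision `(1/8)·2^{-(l-1)}` with octants; quadrants with
  slack `5/32` suffice);
* `quadrantCenter` and, over `ℝ`, `quadrant_core`, `cdist_eighth_le`,
  `cdist_quadrantCenter_le` — **coarse localisation from approximate cosine and sine**: if
  `|ĉ - cos 2πθ| ≤ 1/8` and `|ŝ - sin 2πθ| ≤ 1/8` then the centre of the quadrant given by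
  the signs of `ĉ, ŝ` is within `5/32` of `θ` (mod `1`) (strict Jordan inequality
  `Real.mul_lt_sin`); `cast_cdist`, `cdist_quadrantCenter_le_rat` transport this to rational
  phases.

## References

* A. Yu. Kitaev, *Quantum measurements and the Abelian Stabilizer Problem*,
  arXiv:quant-ph/9511026 (1995), §3, Lemma 10 and the paragraph before it (p. 14 of the arXiv
  version).
* P. W. Shor, *Polynomial-time algorithms for prime factorization and discrete logarithms on a
  quantum computer*, SIAM J. Comput. 26 (1997) 1484–1509, §5 (the theorem served).

## Mathlib

`round`, `round_le`, `abs_sub_round`, `round_add_intCast`, `round_eq_zero_iff`,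
`Rat.round_cast` (generic rounding in `FloorRing`s); `Real.mul_lt_sin`, `Real.mul_le_sin`
(Jordan), `Real.cos_pi_div_four`, `Real.cos_le_cos_of_nonneg_of_le_pi`.
-/

noncomputable section

namespace Literature.Computability.Cryptography

namespace Kitaev1995

open Real

section Generic

/-! The reconstruction is stated over an arbitrary linearly ordered field with a floor function:
the algorithm runs it over `ℚ`, the analysis compares with real phases. -/

variable {𝕜 : Type*} [Field 𝕜] [LinearOrder 𝕜] [IsStrictOrderedRing 𝕜] [FloorRing 𝕜]

/-! ### Circular distance on `𝕜/ℤ` -/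

/-- The distance from `a - b` to the nearest integer: the metric of `ℝ/ℤ` (phases are numbers
`mod 1`, Kitaev 1995, §3, Remark 8). [folklore] -/
def cdist (a b : 𝕜) : 𝕜 := |a - b - round (a - b)|

/-- `cdist` is at most the distance to any integer translate. [folklore] -/
theorem cdist_le_abs (a b : 𝕜) (N : ℤ) : cdist a b ≤ |a - b - N| := round_le _ _

/-- `cdist` is nonnegative. [folklore] -/
theorem cdist_nonneg (a b : 𝕜) : 0 ≤ cdist a b := abs_nonneg _

/-- `cdist ≤ 1/2`. [folklore] -/
theorem cdist_le_half (a b : 𝕜) : cdist a b ≤ 1 / 2 := abs_sub_round _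

omit [IsStrictOrderedRing 𝕜] in
/-- `cdist` is attained at an integer translate. [folklore] -/
theorem exists_cdist_eq (a b : 𝕜) : ∃ N : ℤ, cdist a b = |a - b - N| := ⟨round (a - b), rfl⟩

/-- `cdist` is symmetric. [folklore] -/
theorem cdist_comm (a b : 𝕜) : cdist a b = cdist b a := by
  apply le_antisymm
  · calc cdist a b ≤ |a - b - ((-round (b - a) : ℤ) : 𝕜)| := cdist_le_abs a b _
      _ = cdist b a := by rw [cdist, ← abs_neg]; push_cast; ring_nf
  · calc cdist b a ≤ |b - a - ((-round (a - b) : ℤ) : 𝕜)| := cdist_le_abs b a _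
      _ = cdist a b := by rw [cdist, ← abs_neg]; push_cast; ring_nf

/-- Triangle inequality for `cdist`. [folklore] -/
theorem cdist_triangle (a b c : 𝕜) : cdist a c ≤ cdist a b + cdist b c := by
  calc cdist a c ≤ |a - c - ((round (a - b) + round (b - c) : ℤ) : 𝕜)| := cdist_le_abs a c _
    _ = |(a - b - round (a - b)) + (b - c - round (b - c))| := by push_cast; ring_nf
    _ ≤ cdist a b + cdist b c := abs_add_le _ _

omit [IsStrictOrderedRing 𝕜] in
/-- `cdist` is invariant under a common shift. [folklore] -/
theorem cdist_add_right (a b c : 𝕜) : cdist (a + c) (b + c) = cdist a b := by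
  simp only [cdist, add_sub_add_right_eq_sub]

/-- `cdist` is invariant under integer shifts of the first argument. [folklore] -/
theorem cdist_add_int (a b : 𝕜) (N : ℤ) : cdist (a + N) b = cdist a b := by
  rw [cdist, cdist, show a + N - b = a - b + N by ring, round_add_intCast]
  push_cast; ring_nf

/-- `cdist` is invariant under integer shifts of the second argument. [folklore] -/
theorem cdist_add_int_right (a b : 𝕜) (N : ℤ) : cdist a (b + N) = cdist a b := by
  rw [cdist_comm, cdist_add_int, cdist_comm]

/-- Antipodal points are at circular distance `1/2`. [folklore] -/
theorem cdist_self_add_half (a : 𝕜) : cdist a (a + 1 / 2) = 1 / 2 := by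
  rw [cdist, show a - (a + 1 / 2) = -(1 / 2 : 𝕜) by ring]
  have : round (-(1 / 2 : 𝕜)) = 0 := by
    rw [round_eq_zero_iff]; constructor <;> norm_num
  rw [this]; norm_num

/-- Halving: if `a` is within `δ` of `2θ` modulo `1`, then one of `a/2`, `(a+1)/2` is within
`δ/2` of `θ` and the other within `δ/2` of `θ + 1/2` (modulo `1`) (Kitaev 1995, §3, proof of
Lemma 10: "using this information one can find the value of `φ` with precision `2^{-l-2}`").
[cite: Kitaev1995, §3 Lemma 10] -/
theorem exists_halving {a θ δ : 𝕜} (h : cdist a (2 * θ) ≤ δ) :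
    ∃ b : 𝕜, (b = 0 ∨ b = 1) ∧ cdist ((a + b) / 2) θ ≤ δ / 2 ∧
      cdist ((a + (1 - b)) / 2) (θ + 1 / 2) ≤ δ / 2 := by
  set N := round (a - 2 * θ) with hN
  have hε : |a - 2 * θ - N| ≤ δ := h
  rcases Int.even_or_odd N with ⟨M, hM⟩ | ⟨M, hM⟩
  · refine ⟨0, Or.inl rfl, ?_, ?_⟩
    · calc cdist ((a + 0) / 2) θ ≤ |(a + 0) / 2 - θ - (M : ℤ)| := cdist_le_abs _ _ _
        _ = |a - 2 * θ - N| / 2 := by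
          rw [hM, show |a - 2 * θ - ((M + M : ℤ) : 𝕜)| / 2 = |(a - 2 * θ - ((M + M : ℤ) : 𝕜)) / 2|
            by rw [abs_div, abs_two]]
          push_cast; ring_nf
        _ ≤ δ / 2 := by linarith
    · calc cdist ((a + (1 - 0)) / 2) (θ + 1 / 2) ≤ |(a + (1 - 0)) / 2 - (θ + 1 / 2) - (M : ℤ)| :=
            cdist_le_abs _ _ _
        _ = |a - 2 * θ - N| / 2 := by
          rw [hM, show |a - 2 * θ - ((M + M : ℤ) : 𝕜)| / 2 = |(a - 2 * θ - ((M + M : ℤ) : 𝕜)) / 2|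
            by rw [abs_div, abs_two]]
          push_cast; ring_nf
        _ ≤ δ / 2 := by linarith
  · refine ⟨1, Or.inr rfl, ?_, ?_⟩
    · calc cdist ((a + 1) / 2) θ ≤ |(a + 1) / 2 - θ - ((M + 1 : ℤ) : 𝕜)| := cdist_le_abs _ _ _
        _ = |a - 2 * θ - N| / 2 := by
          rw [hM, show |a - 2 * θ - ((2 * M + 1 : ℤ) : 𝕜)| / 2 =
            |(a - 2 * θ - ((2 * M + 1 : ℤ) : 𝕜)) / 2| by rw [abs_div, abs_two]]
          push_cast; ring_nf
        _ ≤ δ / 2 := by linarith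
    · calc cdist ((a + (1 - 1)) / 2) (θ + 1 / 2) ≤ |(a + (1 - 1)) / 2 - (θ + 1 / 2) - (M : ℤ)| :=
            cdist_le_abs _ _ _
        _ = |a - 2 * θ - N| / 2 := by
          rw [hM, show |a - 2 * θ - ((2 * M + 1 : ℤ) : 𝕜)| / 2 =
            |(a - 2 * θ - ((2 * M + 1 : ℤ) : 𝕜)) / 2| by rw [abs_div, abs_two]]
          push_cast; ring_nf
        _ ≤ δ / 2 := by linarith

/-! ### Halving towards the level estimate -/

/-- One refinement step (Kitaev 1995, §3, Lemma 10): from an estimate `a` of `2θ (mod 1)` and a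
coarse localisation `β` of `θ`, the half `a/2` or `(a+1)/2` closer to `β` modulo `1`.
[cite: Kitaev1995, §3 Lemma 10] -/
def halveTowards (a β : 𝕜) : 𝕜 :=
  if cdist (a / 2) β ≤ cdist ((a + 1) / 2) β then a / 2 else (a + 1) / 2

/-- **Correctness of one refinement step**: if `a` is within `δ ≤ 5/32` of `2θ` and `β` within
`5/32` of `θ` (modulo `1`), then `halveTowards a β` is within `δ/2` of `θ`.
[cite: Kitaev1995, §3 Lemma 10] -/
theorem cdist_halveTowards_le {a β θ δ : 𝕜} (hδ : δ ≤ 5 / 32) (ha : cdist a (2 * θ) ≤ δ)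
    (hβ : cdist β θ ≤ 5 / 32) : cdist (halveTowards a β) θ ≤ δ / 2 := by
  obtain ⟨b, hb, hgood, hbad⟩ := exists_halving ha
  have hδ0 : 0 ≤ δ := le_trans (cdist_nonneg _ _) ha
  -- the good half is close to `β`, the bad half is far from `β`
  have hclose : cdist ((a + b) / 2) β ≤ δ / 2 + 5 / 32 :=
    le_trans (cdist_triangle _ θ _) (add_le_add hgood (by rwa [cdist_comm]))
  have hfar : 1 / 2 - δ / 2 - 5 / 32 ≤ cdist ((a + (1 - b)) / 2) β := by
    have h1 : (1 / 2 : 𝕜) ≤ cdist θ ((a + (1 - b)) / 2) + δ / 2 := by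
      have t1 := cdist_self_add_half θ
      have t2 := cdist_triangle θ ((a + (1 - b)) / 2) (θ + 1 / 2)
      linarith
    have h2 : cdist θ ((a + (1 - b)) / 2) ≤ cdist θ β + cdist β ((a + (1 - b)) / 2) :=
      cdist_triangle _ _ _
    rw [cdist_comm θ β, cdist_comm β ((a + (1 - b)) / 2)] at h2
    linarith
  have hlt : cdist ((a + b) / 2) β < cdist ((a + (1 - b)) / 2) β := by linarith
  unfold halveTowards
  rcases hb with rfl | rfl
  · simp only [add_zero, sub_zero] at hlt hgood
    rw [if_pos hlt.le]
    exact hgood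
  · simp only [sub_self, add_zero] at hlt hgood
    rw [if_neg (not_le.2 hlt)]
    exact hgood

/-- **Kitaev's refinement from the top level down** (Kitaev 1995, §3, Lemma 10): given the
level localisations `β l` of `2^l φ` (`l < L`), `refineAux β L d` estimates `2^{L-1-d} φ`:
start with `β (L-1)` and halve towards the next lower level. [cite: Kitaev1995, §3 Lemma 10] -/
def refineAux (β : ℕ → 𝕜) (L : ℕ) : ℕ → 𝕜
  | 0 => β (L - 1)
  | d + 1 => halveTowards (refineAux β L d) (β (L - 1 - (d + 1)))

/-- The refined estimate of `φ` itself (level `0`). [cite: Kitaev1995, §3 Lemma 10] -/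
def refined (β : ℕ → 𝕜) (L : ℕ) : 𝕜 := refineAux β L (L - 1)

/-- **Precision of the refinement** (Kitaev 1995, §3, Lemma 10: precision
`(1/8)·2^{-(l-1)}`; here `(5/32)·2^{-d}` at depth `d`): if every level localisation is within
`5/32`, then `refineAux β L d` is within `(5/32)/2^d` of `2^{L-1-d} φ` modulo `1`.
[cite: Kitaev1995, §3 Lemma 10] -/
theorem cdist_refineAux_le {β : ℕ → 𝕜} {L : ℕ} {φ : 𝕜}
    (hβ : ∀ l, l < L → cdist (β l) (2 ^ l * φ) ≤ 5 / 32) :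
    ∀ d, d < L → cdist (refineAux β L d) (2 ^ (L - 1 - d) * φ) ≤ 5 / 32 / 2 ^ d := by
  intro d
  induction d with
  | zero =>
    intro hL
    simpa [refineAux] using hβ (L - 1) (by omega)
  | succ d ih =>
    intro hd
    have ih' := ih (by omega)
    rw [refineAux, pow_succ, ← div_div]
    refine cdist_halveTowards_le ?_ ?_ (hβ _ (by omega))
    · exact le_trans (div_le_self (by norm_num) (one_le_pow₀ (by norm_num))) le_rfl
    · rw [show 2 * (2 ^ (L - 1 - (d + 1)) * φ) = 2 ^ (L - 1 - d) * φ by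
        rw [← mul_assoc, ← pow_succ', show L - 1 - (d + 1) + 1 = L - 1 - d by omega]]
      exact ih'

/-- **Precision of the refined phase estimate**: within `(5/32)/2^{L-1}` of `φ` modulo `1`.
[cite: Kitaev1995, §3 Lemma 10] -/
theorem cdist_refined_le {β : ℕ → 𝕜} {L : ℕ} {φ : 𝕜} (hL : 0 < L)
    (hβ : ∀ l, l < L → cdist (β l) (2 ^ l * φ) ≤ 5 / 32) :
    cdist (refined β L) φ ≤ 5 / 32 / 2 ^ (L - 1) := by
  have := cdist_refineAux_le hβ (L - 1) (by omega)
  rw [refined]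
  simpa using this



/-- The centre of the quadrant read off the signs of the estimated cosine and sine
(`true` = nonnegative): `1/8, 3/8, 5/8, 7/8`. (Kitaev 1995, §3, Lemma 10 localises in octants;
quadrants with the `5/32` slack suffice for the halving refinement.)
[cite: Kitaev1995, §3 Lemma 10] -/
def quadrantCenter (cpos spos : Bool) : 𝕜 :=
  if cpos then (if spos then 1 / 8 else 7 / 8) else (if spos then 3 / 8 else 5 / 8)

end Generic

section RealPhases

/-! ### Localising a phase in a quadrant from approximate cosine and sine -/

/-- `sin x > 1/8` for `π/16 < x < π/2` (strict Jordan inequality `sin x > (2/π) x`). [folklore] -/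
theorem one_eighth_lt_sin {x : ℝ} (h1 : π / 16 < x) (h2 : x < π / 2) : 1 / 8 < Real.sin x := by
  have hx0 : 0 < x := lt_trans (by positivity) h1
  have hJ := Real.mul_lt_sin hx0 h2
  have hπ : 0 < π := Real.pi_pos
  have : 2 / π * (π / 16) = 1 / 8 := by field_simp; ring
  have hmono : 2 / π * (π / 16) < 2 / π * x := mul_lt_mul_of_pos_left h1 (by positivity)
  linarith

/-- `sin x ≥ 1/2` for `π/4 ≤ x ≤ π/2` (Jordan's inequality). [folklore] -/
theorem half_le_sin {x : ℝ} (h1 : π / 4 ≤ x) (h2 : x ≤ π / 2) : 1 / 2 ≤ Real.sin x := by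
  have hx0 : 0 ≤ x := le_trans (by positivity) h1
  have hJ := Real.mul_le_sin hx0 h2
  have hπ : 0 < π := Real.pi_pos
  have : 2 / π * (π / 4) = 1 / 2 := by field_simp; ring
  have hmono : 2 / π * (π / 4) ≤ 2 / π * x := mul_le_mul_of_nonneg_left h1 (by positivity)
  linarith

/-- `cos x > 1/8` for `0 ≤ x ≤ π/4`. [folklore] -/
theorem one_eighth_lt_cos {x : ℝ} (h1 : 0 ≤ x) (h2 : x ≤ π / 4) : 1 / 8 < Real.cos x := by
  have hmono : Real.cos (π / 4) ≤ Real.cos x :=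
    Real.cos_le_cos_of_nonneg_of_le_pi h1 (by linarith [Real.pi_pos]) h2
  rw [Real.cos_pi_div_four] at hmono
  have h2' : (1 : ℝ) < Real.sqrt 2 := Real.one_lt_sqrt_two
  linarith

/-- **Core localisation**: a representative `t ∈ [-3/8, 5/8]` of the phase with
`cos 2πt ≥ -1/8` and `sin 2πt ≥ -1/8` lies in `[-1/32, 9/32]`, i.e. within `5/32` of the
quadrant centre `1/8` (Kitaev 1995, §3, Lemma 10: localising `2^j φ` "in one of the 8
intervals"; here quadrants with slack). [cite: Kitaev1995, §3 Lemma 10] -/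
theorem quadrant_core {t : ℝ} (ht1 : -(3 / 8 : ℝ) ≤ t) (ht2 : t ≤ 5 / 8)
    (hc : -(1 / 8 : ℝ) ≤ Real.cos (2 * π * t)) (hs : -(1 / 8 : ℝ) ≤ Real.sin (2 * π * t)) :
    -(1 / 32 : ℝ) ≤ t ∧ t ≤ 9 / 32 := by
  have hπ : 0 < π := Real.pi_pos
  constructor
  · by_contra hlt
    push Not at hlt
    by_cases hq : t ≤ -(1 / 4 : ℝ)
    · -- deep in the lower half plane: `sin 2πt ≤ -1/2`
      set x := 2 * π * t + π with hx
      have hx1 : π / 4 ≤ x := by rw [hx]; nlinarith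
      have hx2 : x ≤ π / 2 := by rw [hx]; nlinarith
      have hsin : Real.sin (2 * π * t) = -Real.sin x := by
        rw [hx, show 2 * π * t = (2 * π * t + π) - π by ring, Real.sin_sub_pi]
        ring_nf
      have := half_le_sin hx1 hx2
      linarith
    · push Not at hq
      set x := -(2 * π * t) with hx
      have hx1 : π / 16 < x := by rw [hx]; nlinarith
      have hx2 : x < π / 2 := by rw [hx]; nlinarith
      have hsin : Real.sin (2 * π * t) = -Real.sin x := by
        rw [hx, Real.sin_neg, neg_neg]
      have := one_eighth_lt_sin hx1 hx2
      linarith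
  · by_contra hlt
    push Not at hlt
    by_cases hq : (1 / 2 : ℝ) ≤ t
    · set x := 2 * π * t - π with hx
      have hx1 : 0 ≤ x := by rw [hx]; nlinarith
      have hx2 : x ≤ π / 4 := by rw [hx]; nlinarith
      have hcos : Real.cos (2 * π * t) = -Real.cos x := by
        rw [hx, show 2 * π * t = (2 * π * t - π) + π by ring, Real.cos_add_pi]
        ring_nf
      have := one_eighth_lt_cos hx1 hx2
      linarith
    · push Not at hq
      set x := 2 * π * t - π / 2 with hx
      have hx1 : π / 16 < x := by rw [hx]; nlinarith
      have hx2 : x < π / 2 := by rw [hx]; nlinarith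
      have hcos : Real.cos (2 * π * t) = -Real.sin x := by
        rw [hx, show 2 * π * t = (2 * π * t - π / 2) + π / 2 by ring, Real.cos_add_pi_div_two]
        ring_nf
      have := one_eighth_lt_sin hx1 hx2
      linarith

/-- **The first-quadrant case**: if `cos 2πθ ≥ -1/8` and `sin 2πθ ≥ -1/8` then `θ` is within
`5/32` of `1/8` modulo `1`. [cite: Kitaev1995, §3 Lemma 10] -/
theorem cdist_eighth_le {θ : ℝ} (hc : -(1 / 8 : ℝ) ≤ Real.cos (2 * π * θ))
    (hs : -(1 / 8 : ℝ) ≤ Real.sin (2 * π * θ)) : cdist (1 / 8) θ ≤ 5 / 32 := by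
  set N := round (θ - 1 / 8) with hN
  have hround : |θ - 1 / 8 - N| ≤ 1 / 2 := abs_sub_round _
  set t := θ - N with ht
  have ht1 : -(3 / 8 : ℝ) ≤ t := by rw [ht]; have := (abs_le.1 hround).1; linarith
  have ht2 : t ≤ 5 / 8 := by rw [ht]; have := (abs_le.1 hround).2; linarith
  have hct : Real.cos (2 * π * t) = Real.cos (2 * π * θ) := by
    rw [ht, show 2 * π * (θ - N) = 2 * π * θ - N * (2 * π) by ring, Real.cos_sub_int_mul_two_pi]
  have hst : Real.sin (2 * π * t) = Real.sin (2 * π * θ) := by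
    rw [ht, show 2 * π * (θ - N) = 2 * π * θ - N * (2 * π) by ring, Real.sin_sub_int_mul_two_pi]
  obtain ⟨h1, h2⟩ := quadrant_core ht1 ht2 (hct ▸ hc) (hst ▸ hs)
  calc cdist (1 / 8) θ ≤ |1 / 8 - θ - ((-N : ℤ) : ℝ)| := cdist_le_abs _ _ _
    _ = |1 / 8 - t| := by rw [ht]; push_cast; ring_nf
    _ ≤ 5 / 32 := abs_le.2 ⟨by linarith, by linarith⟩

/-- **Quadrant localisation from approximate cosine and sine**: if `ĉ`, `ŝ` are within `1/8`
of `cos 2πθ`, `sin 2πθ`, then the centre of the quadrant given by their signs is within `5/32`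
of `θ` modulo `1`. [cite: Kitaev1995, §3 Lemma 10] -/
theorem cdist_quadrantCenter_le {θ c s : ℝ} (hc : |c - Real.cos (2 * π * θ)| ≤ 1 / 8)
    (hs : |s - Real.sin (2 * π * θ)| ≤ 1 / 8) :
    cdist (quadrantCenter (decide (0 ≤ c)) (decide (0 ≤ s)) : ℝ) θ ≤ 5 / 32 := by
  have hc' := abs_le.1 hc
  have hs' := abs_le.1 hs
  unfold quadrantCenter
  by_cases h0c : 0 ≤ c <;> by_cases h0s : 0 ≤ s <;>
    simp only [h0c, h0s, decide_true, decide_false, if_true, if_false, Bool.false_eq_true]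
  · -- first quadrant
    exact cdist_eighth_le (by linarith) (by linarith)
  · -- fourth quadrant: rotate by `3/4`
    have h := cdist_eighth_le (θ := θ - 3 / 4) ?_ ?_
    · rw [show (7 / 8 : ℝ) = 1 / 8 + 3 / 4 by norm_num, show θ = θ - 3 / 4 + 3 / 4 by ring,
        cdist_add_right]
      exact h
    · rw [show 2 * π * (θ - 3 / 4) = 2 * π * θ + π / 2 - 2 * π by ring, Real.cos_sub_two_pi,
        Real.cos_add_pi_div_two]
      push Not at h0s; linarith
    · rw [show 2 * π * (θ - 3 / 4) = 2 * π * θ + π / 2 - 2 * π by ring, Real.sin_sub_two_pi,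
        Real.sin_add_pi_div_two]
      linarith
  · -- second quadrant: rotate by `1/4`
    have h := cdist_eighth_le (θ := θ - 1 / 4) ?_ ?_
    · rw [show (3 / 8 : ℝ) = 1 / 8 + 1 / 4 by norm_num, show θ = θ - 1 / 4 + 1 / 4 by ring,
        cdist_add_right]
      exact h
    · rw [show 2 * π * (θ - 1 / 4) = 2 * π * θ - π / 2 by ring, Real.cos_sub_pi_div_two]
      linarith
    · rw [show 2 * π * (θ - 1 / 4) = 2 * π * θ - π / 2 by ring, Real.sin_sub_pi_div_two]
      push Not at h0c; linarith
  · -- third quadrant: rotate by `1/2`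
    have h := cdist_eighth_le (θ := θ - 1 / 2) ?_ ?_
    · rw [show (5 / 8 : ℝ) = 1 / 8 + 1 / 2 by norm_num, show θ = θ - 1 / 2 + 1 / 2 by ring,
        cdist_add_right]
      exact h
    · rw [show 2 * π * (θ - 1 / 2) = 2 * π * θ - π by ring, Real.cos_sub_pi]
      push Not at h0c; linarith
    · rw [show 2 * π * (θ - 1 / 2) = 2 * π * θ - π by ring, Real.sin_sub_pi]
      push Not at h0s; linarith


/-! ### The rational instance -/

/-- Casting `ℚ → ℝ` commutes with the circular distance. [folklore] -/
theorem cast_cdist (a b : ℚ) : ((cdist a b : ℚ) : ℝ) = cdist (a : ℝ) (b : ℝ) := by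
  rw [cdist, cdist, ← Rat.cast_sub, Rat.round_cast]
  push_cast
  rfl

/-- Casting `ℚ → ℝ` commutes with `quadrantCenter`. [folklore] -/
theorem cast_quadrantCenter (cpos spos : Bool) :
    ((quadrantCenter cpos spos : ℚ) : ℝ) = quadrantCenter cpos spos := by
  unfold quadrantCenter
  cases cpos <;> cases spos <;> simp

/-- **Quadrant localisation of a rational phase** (the form used by the algorithm, which
computes over `ℚ`): if `ĉ`, `ŝ` are within `1/8` of `cos 2πφ`, `sin 2πφ` for a rational `φ`,
then the rational quadrant centre is within `5/32` of `φ` modulo `1`.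
[cite: Kitaev1995, §3 Lemma 10] -/
theorem cdist_quadrantCenter_le_rat {φ : ℚ} {c s : ℝ}
    (hc : |c - Real.cos (2 * π * φ)| ≤ 1 / 8) (hs : |s - Real.sin (2 * π * φ)| ≤ 1 / 8) :
    cdist (quadrantCenter (decide (0 ≤ c)) (decide (0 ≤ s)) : ℚ) φ ≤ 5 / 32 := by
  have h := cdist_quadrantCenter_le hc hs
  rw [← cast_quadrantCenter, ← cast_cdist, show (5 / 32 : ℝ) = ((5 / 32 : ℚ) : ℝ) by norm_num] at h
  exact Rat.cast_le.1 h

end RealPhases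

end Kitaev1995

end Literature.Computability.Cryptography

end
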